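import Literature.Analysis.FluidPDE.DuchonRobertSymmTestField
import HarnessLib

/-!
# Duchon–Robert's regularised symmetric test field is admissible: proof of (E1)

Analysis/FluidPDE proof file: the discharge `Torus.drTestApprox_isSpaceTimeTestIoo_holds` of the
named step fact (E1) `Torus.drTestApprox_isSpaceTimeTestIoo` of `FluidPDE/DuchonRobertSymmTestField`
(Duchon–Robert 2000, proof of Prop. 1, p. 250; the regularisation "mollify in time as well" of
Cheskidov–Constantin–Friedlander–Shvydkoy 2008, §3.1): the field
`Φ = (ρ ⊗ k) ⋆ [ψ w^K + (ψ w) ⋆ K]`, `w = (ρ ⊗ k) ⋆ ū` (`Torus.drTestApprox`), is a space–time test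
field supported in `(0, T)`:

* the inner field `(s, x) ↦ ψ(s,x) (wⱼ(s) ⋆ K)(x) + ((ψ(s) wⱼ(s)) ⋆ K)(x)` is bounded, jointly
  measurable and supported in `[a, b] × T^d` (the time support of `ψ`), hence integrable on
  `ℝ × T^d` (`Torus.integrable_symmTestField_inner`); `wⱼ = (ρ ⊗ k) ⋆ ūⱼ` is bounded and has a
  smooth space–time lift (the tree's `Torus.contDiff_top_stLift_stConv`, `exists_abs_stConv_le`);
* so each component of `Φ`, a space–time mollification of an integrable field by the smooth product
  kernel `ρ ⊗ k`, has a smooth space–time lift (`Torus.contDiff_top_stLift_stConv`), and vanishes for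
  `t ≤ a - rOut` and `t ≥ b + rOut` (the integrand vanishes: `ψ(s) = 0` off `(a, b)`,
  `ρ(t - s) = 0` for `|t - s| ≥ rOut`), which lie in `(0, T)` by the smallness of the radius.

## References

* J. Duchon, R. Robert, Nonlinearity 13 (2000), proof of Prop. 1 (p. 250). [DuchonRobert2000]
* A. Cheskidov, P. Constantin, S. Friedlander, R. Shvydkoy, Nonlinearity 21 (2008), §3.1. [CCFS2008]
-/

noncomputable section

open MeasureTheory Set Filter Topology Function UnitAddTorus
open scoped ENNReal NNReal Convolution ContDiff InnerProductSpace

namespace Literature.Analysis.FluidPDE.Torus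

open Literature.Analysis.FunctionSpaces

variable {d : Type*} [Fintype d] [DecidableEq d]

section Admissible

variable {ρ : ℝ → ℝ} {k K : UnitAddTorus d → ℝ} {ψ : ℝ → UnitAddTorus d → ℝ}

omit [DecidableEq d] in
/-- A field with continuous space–time lift, mollified in space by a continuous kernel, is bounded
by `sup|w| ∫|K|`-type constants and jointly measurable. [folklore] -/
theorem bound_and_measurable_sliceConv {w : ℝ → UnitAddTorus d → ℝ} {C : ℝ} (hwC : ∀ t x, |w t x| ≤ C)
    (hwc : Continuous (uncurry w)) (hK : Continuous K) :
    (∀ t x, |((w t) ⋆ K) x| ≤ C * ∫ y, ‖K y‖) ∧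
      AEStronglyMeasurable (fun q : ℝ × UnitAddTorus d => ((w q.1) ⋆ K) q.2) ((volume : Measure ℝ).prod volume) := by
  constructor
  · intro t x
    rw [← Real.norm_eq_abs, FunctionSpaces.Torus.convolution_comm_real]
    -- `‖(K ⋆ w t)(x)‖ ≤ C ∫ |K|`
    have h := FunctionSpaces.Torus.norm_convolution_le (F := ℝ) hK.integrable_unitAddTorus
      (k := w t) (C := C) (fun y => by rw [Real.norm_eq_abs]; exact hwC t y) x
    simpa using h
  · exact FunctionSpaces.Torus.aestronglyMeasurable_uncurry_convolution (ContinuousLinearMap.lsmul ℝ ℝ)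
      hwc.aestronglyMeasurable hK

omit [DecidableEq d] in
/-- The symmetric test field with zero cut-off vanishes. [folklore] -/
theorem symmTestField_zero_cutoff (K : UnitAddTorus d → ℝ) (v : UnitAddTorus d → EuclideanSpace ℝ d) :
    symmTestField K (0 : UnitAddTorus d → ℝ) v = 0 := by
  funext x
  have e : (fun y => (0 : UnitAddTorus d → ℝ) y • v y) = 0 := by funext y; simp
  rw [symmTestField_apply, e, vecConv_zero]
  simp

omit [DecidableEq d] in
/-- **The inner field of the regularised symmetric test field is integrable on `ℝ × T^d`**: for a
bounded field `w` with continuous space–time lift, a continuous kernel `K` and a cut-off `ψ` with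
continuous space–time lift supported in `[a, b]` in time, each component
`(s, x) ↦ ψ(s,x) (wⱼ(s) ⋆ K)(x) + ((ψ(s) wⱼ(s)) ⋆ K)(x)` of `symmTestField K (ψ s) (w s)` is bounded,
jointly measurable and supported in `[a, b] × T^d`. [folklore] -/
theorem integrable_symmTestField_inner {w : ℝ → UnitAddTorus d → EuclideanSpace ℝ d} {C : ℝ}
    (hwC : ∀ t x j, |w t x j| ≤ C) (hwc : ∀ j, Continuous (uncurry fun t x => w t x j))
    (hK : Continuous K) (hψc : Continuous (uncurry ψ)) {Cψ : ℝ} (hψC : ∀ t x, |ψ t x| ≤ Cψ)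
    {a b : ℝ} (hψab : ∀ t, t ∉ Icc a b → ψ t = 0) (j : d) :
    Integrable (fun q : ℝ × UnitAddTorus d => symmTestField K (ψ q.1) (w q.1) q.2 j)
      ((volume : Measure ℝ).prod volume) := by
  set μ : Measure (ℝ × UnitAddTorus d) := (volume : Measure ℝ).prod volume with hμ
  -- the two terms
  obtain ⟨hb1, hm1⟩ := bound_and_measurable_sliceConv (w := fun t x => w t x j) (fun t x => hwC t x j) (hwc j) hK
  have hψw : Continuous (uncurry fun t x => ψ t x * w t x j) := hψc.mul (hwc j)
  have hψwC : ∀ t x, |ψ t x * w t x j| ≤ Cψ * C := fun t x => by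
    rw [abs_mul]; exact mul_le_mul (hψC t x) (hwC t x j) (abs_nonneg _) ((abs_nonneg _).trans (hψC t x))
  obtain ⟨hb2, hm2⟩ := bound_and_measurable_sliceConv (w := fun t x => ψ t x * w t x j) hψwC hψw hK
  -- the component
  have hcomp : ∀ q : ℝ × UnitAddTorus d, symmTestField K (ψ q.1) (w q.1) q.2 j =
      ψ q.1 q.2 * ((fun z => w q.1 z j) ⋆ K) q.2 + ((fun z => ψ q.1 z * w q.1 z j) ⋆ K) q.2 := fun q =>
    symmTestField_apply_apply K (ψ q.1) (w q.1) q.2 j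
  have hmeas : AEStronglyMeasurable (fun q : ℝ × UnitAddTorus d => symmTestField K (ψ q.1) (w q.1) q.2 j) μ := by
    have hψm : AEStronglyMeasurable (fun q : ℝ × UnitAddTorus d => ψ q.1 q.2) μ := hψc.aestronglyMeasurable
    refine ((hψm.mul hm1).add hm2).congr (ae_of_all _ fun q => ?_)
    exact (hcomp q).symm
  -- the bound and the support
  set M : ℝ := Cψ * (C * ∫ y, ‖K y‖) + Cψ * C * ∫ y, ‖K y‖ with hM
  have hbound : ∀ q : ℝ × UnitAddTorus d, ‖symmTestField K (ψ q.1) (w q.1) q.2 j‖ ≤ M := fun q => by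
    rw [Real.norm_eq_abs, hcomp q]
    refine (abs_add_le _ _).trans (add_le_add ?_ (hb2 q.1 q.2))
    rw [abs_mul]
    exact mul_le_mul (hψC q.1 q.2) (hb1 q.1 q.2) (abs_nonneg _) ((abs_nonneg _).trans (hψC q.1 q.2))
  have hzero : ∀ q : ℝ × UnitAddTorus d, q.1 ∉ Icc a b → symmTestField K (ψ q.1) (w q.1) q.2 j = 0 := by
    intro q hq
    rw [hψab q.1 hq, symmTestField_zero_cutoff]
    rfl
  -- domination by `M 𝟙_{[a,b] × T^d}`
  have hdom : Integrable (fun q : ℝ × UnitAddTorus d => (Icc a b ×ˢ (univ : Set (UnitAddTorus d))).indicator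
      (fun _ => M) q) μ := by
    refine (integrable_indicator_iff (measurableSet_Icc.prod MeasurableSet.univ)).2 ?_
    refine integrableOn_const ?_
    rw [hμ, Measure.prod_prod, measure_univ, mul_one, Real.volume_Icc]
    exact ENNReal.ofReal_ne_top
  refine hdom.mono' hmeas (ae_of_all _ fun q => ?_)
  by_cases hq : q.1 ∈ Icc a b
  · rw [indicator_of_mem (show q ∈ Icc a b ×ˢ (univ : Set (UnitAddTorus d)) from ⟨hq, mem_univ _⟩)]
    exact hbound q
  · rw [hzero q hq, norm_zero, indicator_apply]
    split_ifs
    · exact (norm_nonneg _).trans (hbound q)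
    · exact le_rfl

omit [DecidableEq d] in
/-- **Support of a space–time mollification in time**: if `F(s, ·) = 0` for `s ∉ [a, b]` and
`ρ` vanishes off `(-δ, δ)`, then `stConv ρ k F (t) = 0` for `t ≤ a - δ` and for `b + δ ≤ t`. [folklore] -/
theorem stConv_eq_zero_of_dist {F : ℝ × UnitAddTorus d → ℝ} {a b δ : ℝ}
    (hF : ∀ q : ℝ × UnitAddTorus d, q.1 ∉ Icc a b → F q = 0) (hρδ : ∀ r, ρ r ≠ 0 → |r| < δ)
    {t : ℝ} (ht : t ≤ a - δ ∨ b + δ ≤ t) (x : UnitAddTorus d) :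
    FunctionSpaces.Torus.stConv ρ k F t x = 0 := by
  rw [FunctionSpaces.Torus.stConv]
  refine integral_eq_zero_of_ae (Eventually.of_forall fun p => ?_)
  by_cases hp : p.1 ∈ Icc a b
  · by_cases hρp : ρ (t - p.1) = 0
    · simp [hρp]
    · exfalso
      have h2 := hρδ _ hρp
      rw [abs_lt] at h2
      rcases ht with ht | ht
      · linarith [hp.1]
      · linarith [hp.2]
  · simp [hF p hp]

omit [DecidableEq d] in
/-- **Discharge of (E1)**: Duchon–Robert's regularised symmetric field `Torus.drTestApprox` is a
space–time test field supported in `(0,T)` when the time radius is small (Duchon–Robert 2000, proof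
of Prop. 1, p. 250; CCFS 2008, §3.1). [cite: DuchonRobert2000, proof of Prop. 1 p. 250] -/
theorem drTestApprox_isSpaceTimeTestIoo_holds : drTestApprox_isSpaceTimeTestIoo (d := d) := by
  intro T u hmeas hu2 φ ε hε hε' K hK ψ hψ a b ha hb hra hrb
  set μ : Measure (ℝ × UnitAddTorus d) := (volume : Measure ℝ).prod volume with hμ
  set ρ : ℝ → ℝ := φ.normed volume with hρ
  set k : UnitAddTorus d → ℝ := FunctionSpaces.Torus.kernel ε with hk
  have hρs : ContDiff ℝ ∞ ρ := φ.contDiff_normed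
  have hρc : HasCompactSupport ρ := φ.hasCompactSupport_normed
  have hρsupp : ∀ r, ρ r ≠ 0 → |r| < φ.rOut := fun r h => abs_lt_of_normed_ne_zero φ h
  have hks : FunctionSpaces.Torus.IsSmooth k := FunctionSpaces.Torus.isSmooth_kernel hε hε'
  -- the extended velocity and its regularisation
  have hm : AEStronglyMeasurable (uncurry u) ((volume.restrict (Ioo 0 T)).prod volume) :=
    aestronglyMeasurable_uncurry_prod_of_stLift_Ioo hmeas
  have hbar1 : Integrable (stBar T u) μ := integrable_stBar hm hu2
  have hU1 : ∀ j, Integrable (fun q => stBar T u q j) μ := fun j =>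
    (EuclideanSpace.proj (𝕜 := ℝ) j).integrable_comp hbar1
  set w : ℝ → UnitAddTorus d → EuclideanSpace ℝ d := drVelocityApprox T u ρ k with hw
  have hwj : ∀ j, (fun t x => w t x j) = FunctionSpaces.Torus.stConv ρ k (fun q => stBar T u q j) := fun j => by
    funext t x; rfl
  have hwsm : ∀ j, ContDiff ℝ ∞ (FunctionSpaces.Torus.stLift fun t x => w t x j) := fun j => by
    rw [hwj j]; exact FunctionSpaces.Torus.contDiff_top_stLift_stConv (hU1 j) hρs hρc hks
  have hwc : ∀ j, Continuous (uncurry fun t x => w t x j) := fun j =>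
    FunctionSpaces.Torus.continuous_uncurry_of_continuous_stLift (hwsm j).continuous
  have hwb : ∀ j, ∃ C, ∀ t x, |w t x j| ≤ C := fun j => by
    obtain ⟨C, hC⟩ := exists_abs_stConv_le (hU1 j) hρs.continuous hρc hks.continuous
    exact ⟨C, fun t x => by rw [show w t x j = FunctionSpaces.Torus.stConv ρ k (fun q => stBar T u q j) t x from rfl]; exact hC t x⟩
  choose Cw hCw using hwb
  set C : ℝ := ∑ j, |Cw j| with hC
  have hwC : ∀ t x j, |w t x j| ≤ C := fun t x j =>
    ((hCw j t x).trans (le_abs_self _)).trans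
      (Finset.single_le_sum (f := fun j => |Cw j|) (fun j _ => abs_nonneg _) (Finset.mem_univ j))
  -- the cut-off: bounded, continuous lift, supported in `[a, b]`
  have hψcont : Continuous (uncurry ψ) := FunctionSpaces.Torus.continuous_uncurry_of_continuous_stLift hψ.continuous
  have hψab : ∀ t, t ∉ Icc a b → ψ t = 0 := fun t ht => by
    rw [mem_Icc, not_and_or, not_le, not_le] at ht
    rcases ht with h | h
    · exact ha t h.le
    · exact hb t h.le
  have hψC : ∃ Cψ, ∀ t x, |ψ t x| ≤ Cψ := by
    obtain ⟨C₀, hC₀⟩ := (isCompact_Icc.prod isCompact_univ).exists_bound_of_continuousOn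
      (s := Icc a b ×ˢ (univ : Set (UnitAddTorus d))) (hψcont.continuousOn)
    refine ⟨max C₀ 0, fun t x => ?_⟩
    by_cases ht : t ∈ Icc a b
    · have h := hC₀ (t, x) ⟨ht, mem_univ _⟩
      rw [Real.norm_eq_abs] at h
      exact h.trans (le_max_left _ _)
    · rw [hψab t ht]
      simp
  obtain ⟨Cψ, hCψ⟩ := hψC
  -- the inner field is integrable, componentwise
  have hG : ∀ j, Integrable (fun q : ℝ × UnitAddTorus d => symmTestField K (ψ q.1) (w q.1) q.2 j) μ := fun j =>
    integrable_symmTestField_inner hwC hwc hK.continuous hψcont hCψ hψab j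
  -- smoothness of the components of `Φ`
  have hΦs : ∀ j, ContDiff ℝ ∞ (FunctionSpaces.Torus.stLift
      (FunctionSpaces.Torus.stConv ρ k fun q : ℝ × UnitAddTorus d => symmTestField K (ψ q.1) (w q.1) q.2 j)) :=
    fun j => FunctionSpaces.Torus.contDiff_top_stLift_stConv (hG j) hρs hρc hks
  have hΦdef : drTestApprox T u ρ k K ψ =
      vecField fun j => FunctionSpaces.Torus.stConv ρ k fun q : ℝ × UnitAddTorus d => symmTestField K (ψ q.1) (w q.1) q.2 j :=
    rfl
  have hsmooth : ContDiff ℝ ∞ (FunctionSpaces.Torus.stLift (drTestApprox T u ρ k K ψ)) := by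
    rw [hΦdef, stLift_vecField]
    exact contDiff_piLp' (p := 2) fun j => hΦs j
  -- time support
  have hzero : ∀ t, (t ≤ a - φ.rOut ∨ b + φ.rOut ≤ t) → drTestApprox T u ρ k K ψ t = 0 := by
    intro t ht
    funext x
    rw [hΦdef]
    ext j
    rw [vecField_apply]
    refine (stConv_eq_zero_of_dist (fun q hq => ?_) hρsupp ht x).trans (by simp)
    rw [hψab q.1 hq, symmTestField_zero_cutoff]
    rfl
  exact ⟨⟨hsmooth, b + φ.rOut, hrb, fun t ht => hzero t (Or.inr ht)⟩, a - φ.rOut, by linarith,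
    fun t ht => hzero t (Or.inl ht)⟩

end Admissible

end Literature.Analysis.FluidPDE.Torus
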